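import Mathlib
import HarnessLib
import Summits.HodgeConjecture.HodgeConjecture.Theses.PadicSemiregularLift
import Literature.AlgebraicGeometry.Crystalline.BlochEsnaultKerzLifting

/-!
# Sketch — crux-ideate stmt-HodgeConjecture-14106 (FormalVectorBundlesAlgebraize), ideator 1

First-lemma signatures of the two idea cards (`twist-presentation-completeness`, `chow-frame-descent`) (not proved; they must only elaborate).
-/

open CategoryTheory AlgebraicGeometry Limits
open Literature.AlgebraicGeometry.Motives Literature.AlgebraicGeometry.Motives.WittScheme
open Literature.AlgebraicGeometry.Crystalline

namespace Summit.HodgeConjecture.HodgeConjecture.Cruxes.FormalVectorBundlesAlgebraize.IdeatorOne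

/-- Card `twist-presentation-completeness`, milestone: the PROJECTIVE case of the crux (all anchors of the
route are projective over `W`). -/
def ProjectiveCase : Prop :=
  ∀ (p : ℕ) [Fact p.Prime] (k : Type) [Field k] [CharP k p] [PerfectRing k p] (d : ℕ)
    (𝒳 : SchemeOver (WittVector p k)), IsSmoothProperModel d 𝒳 → IsProjectiveOverRing 𝒳 →
    ∀ (E₁ : (specialFibre 𝒳).left.Modules), LiftsFormally 𝒳 E₁ → LiftsTo 𝒳 E₁

/-- Card `twist-presentation-completeness`, first lemma (where properness over the complete local base
enters; Görtz–Wedhorn II Prop. 24.95 + Lemma 24.96 in the tree's vocabulary): if an ALGEBRAIC map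
`u : V' ⟶ V` of vector bundles on `𝒳` has vector-bundle cokernels on every thickening `X_{n+1}`,
then `coker u` is a vector bundle on `𝒳`, and it restricts on `X_k` to the cokernel of `u|X_k`. -/
theorem cokernel_isVectorBundle_of_thickenings
    (p : ℕ) [Fact p.Prime] (k : Type) [Field k] [CharP k p] [PerfectRing k p] (d : ℕ)
    (𝒳 : SchemeOver (WittVector p k)) (h𝒳 : IsSmoothProperModel d 𝒳)
    (V V' : 𝒳.left.Modules) (hV : IsVectorBundle V) (hV' : IsVectorBundle V') (u : V' ⟶ V)
    (hu : ∀ n : ℕ, IsVectorBundle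
      (cokernel ((Scheme.Modules.pullback (thickeningι 𝒳 (n + 1))).map u))) :
    IsVectorBundle (cokernel u) ∧
      Nonempty (restrictSpecial 𝒳 (cokernel u) ≅
        cokernel ((Scheme.Modules.pullback (specialFibreι 𝒳)).map u)) := by
  sorry

/-- Card `twist-presentation-completeness`, the limit step in module form (the lever): over the
`p`-adically complete `W = 𝕎 k`, a `p`-adically Cauchy sequence in a FINITE `W`-module `M`
(here: `M = Γ(𝒳, 𝓗om(V', V))`, finite by Serre) has a limit in `M`, and a `W`-linear map to a
finite module `N` that kills it modulo every `p^{n+1}` kills the limit. -/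
theorem exists_limit_of_cauchy_of_finite
    (p : ℕ) [Fact p.Prime] (k : Type) [Field k] [CharP k p] [PerfectRing k p]
    (M N : Type) [AddCommGroup M] [Module (WittVector p k) M] [Module.Finite (WittVector p k) M]
    [AddCommGroup N] [Module (WittVector p k) N] [Module.Finite (WittVector p k) N]
    (φ : M →ₗ[WittVector p k] N) (x : ℕ → M)
    (hx : ∀ n, x (n + 1) - x n ∈ (Ideal.span {(p : WittVector p k)} ^ (n + 1) • ⊤ : Submodule (WittVector p k) M))
    (hφ : ∀ n, φ (x n) ∈ (Ideal.span {(p : WittVector p k)} ^ (n + 1) • ⊤ : Submodule (WittVector p k) N)) :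
    ∃ y : M, (∀ n, y - x n ∈ (Ideal.span {(p : WittVector p k)} ^ (n + 1) • ⊤ : Submodule (WittVector p k) M)) ∧
      φ y = 0 := by
  sorry

/-- Card `chow-frame-descent`, first lemma (the lever): let `π : Z ⟶ 𝒳` be a `W`-morphism from a
`W`-flat projective `W`-scheme with `π_* 𝒪_Z = 𝒪_𝒳` (e.g. a Chow cover of the normal scheme `𝒳`),
and let `G` be a vector bundle on `Z` which on every thickening `Z_{n+1}` is the pull-back of a
vector bundle `E n` on `X_{n+1}`. Then `π_* G` is a vector bundle on `𝒳` restricting to the `E n`. -/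
theorem pushforward_isVectorBundle_of_formally_descended
    (p : ℕ) [Fact p.Prime] (k : Type) [Field k] [CharP k p] [PerfectRing k p] (d : ℕ)
    (𝒳 : SchemeOver (WittVector p k)) (h𝒳 : IsSmoothProperModel d 𝒳)
    (Z : SchemeOver (WittVector p k)) (π : Z ⟶ 𝒳) (hZ : IsProjectiveOverRing Z) [Flat Z.hom]
    (hπ : ∀ U : 𝒳.left.Opens, Function.Bijective (π.left.app U).hom)
    (G : Z.left.Modules) (hG : IsVectorBundle G)
    (E : ∀ n : ℕ, (thickening 𝒳 (n + 1)).left.Modules) (hE : ∀ n, IsVectorBundle (E n))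
    (hEc : ∀ n, Nonempty ((Scheme.Modules.pullback
      (thickeningMap 𝒳 (Nat.le_succ (n + 1)))).obj (E (n + 1)) ≅ E n))
    (hGE : ∀ n, Nonempty ((Scheme.Modules.pullback (thickeningι Z (n + 1))).obj G ≅
      (Scheme.Modules.pullback
        ((baseChange (WittVector p k) (wittQuot p k (n + 1))).map π).left).obj (E n))) :
    IsVectorBundle ((Scheme.Modules.pushforward π.left).obj G) ∧
      ∀ n, Nonempty ((Scheme.Modules.pullback (thickeningι 𝒳 (n + 1))).obj
        ((Scheme.Modules.pushforward π.left).obj G) ≅ E n) := by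
  sorry

/-- Card `chow-frame-descent`, the one-level lifting lemma in module form (Stacks 02OB (3) for
`p = 0`, the mechanism of the tree's `hasSurjectiveFormalFunctions_of_finite_cechH1`): if the
`p^∞`-torsion of the obstruction module `H` (here `H = Ȟ¹(Z_A, 𝓗om(𝒪^e, G))`) is killed by
`p ^ c`, then whatever is the reduction of a level-`(c+1)` section is the reduction of a global
section. Abstract form: `S = Γ(Z_A, 𝓗)`, `δ : S_N → H[p^N]` the connecting maps. -/
theorem reduction_lifts_of_torsion_exponent
    (A : Type) [CommRing A] (p : A) (S H : Type) [AddCommGroup S] [Module A S]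
    [AddCommGroup H] [Module A H] (c : ℕ) (hc : ∀ h : H, (∃ n : ℕ, p ^ n • h = 0) → p ^ c • h = 0)
    (SN S1 : Type) [AddCommGroup SN] [Module A SN] [AddCommGroup S1] [Module A S1]
    (resN : S →ₗ[A] SN) (res1 : S →ₗ[A] S1) (red : SN →ₗ[A] S1) (hred : red ∘ₗ resN = res1)
    (δN : SN →ₗ[A] H) (δ1 : S1 →ₗ[A] H)
    (hδN : ∀ s, p ^ (c + 1) • δN s = 0) (hδ : δ1 ∘ₗ red = p ^ c • δN)
    (hexact1 : LinearMap.ker δ1 = LinearMap.range res1) (s : SN) :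
    red s ∈ LinearMap.range res1 := by
  sorry

end Summit.HodgeConjecture.HodgeConjecture.Cruxes.FormalVectorBundlesAlgebraize.IdeatorOne
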